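import Summits.BirchSwinnertonDyer.BirchSwinnertonDyer.Theorems.KimAtThreeFineKatoKPortGoodSubgroup
import HarnessLib

/-!
# K-PORT: the E-side of LEMMA SAT₀ over an unramified Galois `K ⊇ ℚ_p` at an ADDITIVE prime, assembled —
# kim3's CONSUMER THEOREM modulo (i) the residue-field input "some `P ∈ E₀(K)` has norm `N(P) ∉ E₁(K)`"
# and (ii) kim3's own `(δ)` at `ℚ₃` (cell `bsd-addord`, seat w2-kport gen 0; `--supports 19560`, helper)

HONEST FRAMING. Route W2 (`route-BirchSwinnertonDyer-KimAtThreeKolyvagin`), crux 19560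
`KatoKuriharaPortThreeShared`, residual ⟨C1⟩ clause (C1.c). kim3's brief (KIM3-KPORT-BRIEF-g12 §3) asks
the K-port for the CONSUMER THEOREM `∃ P ∈ E₀(K), Tr_{K/ℚ₃}(log P) ∈ ℤ₃ˣ ∧ ∀ Q ∈ E₀(K), ‖log Q‖ ≤ 1`
for `E = W ⊗ K`, `W/ℚ` globally minimal additive at `3`, `K = K_w` unramified over `ℚ₃`, `log` the
`Gal`-equivariant logarithm extending n1011's `padicLog`. With `log := Λ̃ = KPort.satLog` (files
`…KPortSatLog`, `…SatLogMap`: additive on `Ẽ₁(K) ⊇ E₀(K)`, equivariant, `= padicLog` on `ℚ_p`-points)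
this file ASSEMBLES everything the port proves into one statement, `consumer_of_exists_norm_not_mem_kernel`:
GIVEN a point `P ∈ E₀(K)` whose norm `N(P) = ∑_σ σP` is not in `E₁(K)` (hypothesis `hres` — the
residue-field statement "reduction `E₀(K) ↠ Ẽ_ns(k) ≅ k⁺` is onto an element of nonzero `Tr_{k/𝔽₃}`",
NOT proved here: it needs a `k`-rational cusp chart, `reducePoint` equivariance, `Gal(K/ℚ₃) ↠ Gal(k/𝔽₃)`
and `𝒪_K` henselian — inventory HOME/kport/KPORT-INVENTORY-g0.md (G5)/(G6)), THEN there is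
`P₀ ∈ E₀(ℚ_p) ∖ E₁(ℚ_p)` (kim3's currency `X.goodReductionSubgroup ℤ_[p]`, `X.IsInReductionKernel`) with
`ι P₀ = N(P)` and **`Tr_{K/ℚ_p}(Λ̃ P) = padicLog X P₀`**, and **`‖Λ̃ Q‖ ≤ 1` for all `Q ∈ E₀(K)`**. kim3's
(δ) at `ℚ₃` (`KimAtThreeFineKatoSATPoints.mem_formalFiltration_zero_of_norm_padicLog_le`, `t = 0`,
`3 ∤ c₃`) turns `P₀ ∈ E₀ ∖ E₁` into `padicLog X P₀ ∈ ℤ₃ˣ`. TOOL theorems only (no definition, no named fact,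
no `sorry`); closes nothing by itself; nothing booked.

References: J. H. Silverman, *The Arithmetic of Elliptic Curves*, 2nd ed. (2009), IV.6.4, VII.2
[SilvermanAEC2009]; kim3 brief HOME/kim3/KIM3-KPORT-BRIEF-g12.md §1 (E-K1)–(E-K3), §3.
-/

noncomputable section

-- the cell's Theorems namespace `Summit.BirchSwinnertonDyer.BirchSwinnertonDyer.…` repeats the summit name by design (D-0017)
set_option linter.dupNamespace false

open scoped Classical

namespace Summit.BirchSwinnertonDyer.BirchSwinnertonDyer.Theorems.KPort

open Summit.BirchSwinnertonDyer.Rank1Residual.Additive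
open Summit.BirchSwinnertonDyer.Rank1Residual.Additive.BallEval
open Summit.BirchSwinnertonDyer.Rank1Residual.Additive.LocalLog
open Literature.NumberTheory.GaloisRepresentations.LubinTate (unitBall mem_unitBall_iff)
open Literature.NumberTheory.EllipticCurves Literature.NumberTheory.EllipticCurves.FormalGroupChart
open Literature.NumberTheory.EllipticCurves.Rank1Residual WeierstrassCurve

variable {p : ℕ} [hp : Fact p.Prime] {K : Type*} [NontriviallyNormedField K] [NormedAlgebra ℚ_[p] K]
  [IsUltrametricDist K] [CompleteSpace K] [FiniteDimensional ℚ_[p] K] [IsGalois ℚ_[p] K]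
  (W : WeierstrassCurve ℚ) [W.IsElliptic] [W.IsGloballyMinimal]
  [hint : (curveK p K ((integralModelInt W).map (Int.castRingHom ℤ_[p]))).IsIntegral
    (NormedField.valuation (K := K)).integer]
  [hE : (((integralModelInt W).map (Int.castRingHom ℤ_[p])).map PadicInt.Coe.ringHom).IsElliptic]
  [hX : (((integralModelInt W).map (Int.castRingHom ℤ_[p])).map PadicInt.Coe.ringHom).IsIntegral ℤ_[p]]
  [hX' : (((integralModelInt W).map (Int.castRingHom ℤ_[p])).map PadicInt.Coe.ringHom).IsIntegral
    (NormedField.valuation (K := ℚ_[p])).integer]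
  [hmin : (((integralModelInt W).map (Int.castRingHom ℤ_[p])).map PadicInt.Coe.ringHom).IsMinimal ℤ_[p]]

/-- **The E-side of SAT₀, assembled (modulo the residue-field input `hres` and kim3's `(δ)`).** Let
`M = W_ℤ ⊗ ℤ_p`, `X = M ⊗ ℚ_p`, `E = M ⊗ K = curveK p K M` for `W/ℚ` globally minimal with `Addv W p` and
`K/ℚ_p` finite Galois, complete ultrametric and unramified (`hK`). If some `P ∈ E₀(K)` has
`N(P) = ∑_σ σP ∉ E₁(K)`, then (a) there is `P₀ ∈ X.goodReductionSubgroup ℤ_[p]` (= `E₀(ℚ_p)`) with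
`¬ X.IsInReductionKernel P₀` (`∉ E₁(ℚ_p)`), `ι P₀ = N(P)` and `Tr_{K/ℚ_p}(Λ̃ P) = padicLog X P₀`, and
(b) `‖Λ̃ Q‖ ≤ 1` for every `Q ∈ E₀(K)`. [cite: SilvermanAEC2009, IV.6.4 and VII.2 Prop. 2.1–2.2] -/
theorem consumer_of_exists_norm_not_mem_kernel (hadd : Addv W p)
    (hK : ∀ x : K, ‖x‖ < 1 → ‖x‖ ≤ ‖(p : K)‖)
    (hres : ∃ P ∈ (((integralModelInt W).map (Int.castRingHom ℤ_[p])).map (coeffHom p K)).nonsingularReductionSubgroup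
        (Valuation.integer.integers (NormedField.valuation (K := K))),
      (∑ σ : K ≃ₐ[ℚ_[p]] K, Affine.Point.map
          (W' := (((integralModelInt W).map (Int.castRingHom ℤ_[p])).map PadicInt.Coe.ringHom).toAffine)
          (σ : K →ₐ[ℚ_[p]] K) P) ∉
        kernel (NormedField.valuation (K := K)) (curveK p K ((integralModelInt W).map (Int.castRingHom ℤ_[p])))) :
    (∃ P ∈ (((integralModelInt W).map (Int.castRingHom ℤ_[p])).map (coeffHom p K)).nonsingularReductionSubgroup
        (Valuation.integer.integers (NormedField.valuation (K := K))),
      ∃ P₀ : (((integralModelInt W).map (Int.castRingHom ℤ_[p])).map PadicInt.Coe.ringHom).toAffine.Point,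
        P₀ ∈ (((integralModelInt W).map (Int.castRingHom ℤ_[p])).map PadicInt.Coe.ringHom).goodReductionSubgroup
            ℤ_[p] ∧
          ¬ (((integralModelInt W).map (Int.castRingHom ℤ_[p])).map PadicInt.Coe.ringHom).IsInReductionKernel P₀ ∧
          Affine.Point.map
              (W' := (((integralModelInt W).map (Int.castRingHom ℤ_[p])).map PadicInt.Coe.ringHom).toAffine)
              (Algebra.ofId ℚ_[p] K) P₀ =
            ∑ σ : K ≃ₐ[ℚ_[p]] K, Affine.Point.map
              (W' := (((integralModelInt W).map (Int.castRingHom ℤ_[p])).map PadicInt.Coe.ringHom).toAffine)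
              (σ : K →ₐ[ℚ_[p]] K) P ∧
          Algebra.trace ℚ_[p] K (satLog p K ((integralModelInt W).map (Int.castRingHom ℤ_[p])) P) =
            padicLog (((integralModelInt W).map (Int.castRingHom ℤ_[p])).map PadicInt.Coe.ringHom) P₀) ∧
    ∀ Q ∈ (((integralModelInt W).map (Int.castRingHom ℤ_[p])).map (coeffHom p K)).nonsingularReductionSubgroup
        (Valuation.integer.integers (NormedField.valuation (K := K))),
      ‖satLog p K ((integralModelInt W).map (Int.castRingHom ℤ_[p])) Q‖ ≤ 1 := by
  refine ⟨?_, fun Q hQ => norm_satLog_le_one_of_mem_nonsingularReductionSubgroup_of_addv W hadd hK hQ⟩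
  obtain ⟨P, hP, hN⟩ := hres
  obtain ⟨P₀, hP₀⟩ := exists_map_ofId_eq_sum_galois (M := (integralModelInt W).map (Int.castRingHom ℤ_[p])) P
  have hPsat : P ∈ satKernel p K ((integralModelInt W).map (Int.castRingHom ℤ_[p])) :=
    nonsingularReductionSubgroup_le_satKernel_of_addv W hadd hP
  refine ⟨P, hP, P₀, ?_, ?_, hP₀, trace_satLog_eq_padicLog hPsat hP₀⟩
  · rw [← map_ofId_mem_nonsingularReductionSubgroup_iff_mem_goodReductionSubgroup (K := K), hP₀]
    exact sum_galois_mem_nonsingularReductionSubgroup hP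
  · rw [← sum_galois_mem_kernel_iff hP₀]
    exact hN

omit [CompleteSpace K] [IsGalois ℚ_[p] K] [W.IsElliptic] hE hX hX' hmin in
/-- The residue-field input `hres` restated in the two-sided form the reduction theory will deliver it:
`N(P) ∈ E₁(K) ↔ …` is about `E₀(K)/E₁(K)`, on which `N` acts; recorded here as the trivial
reformulation "`∃ P ∈ E₀(K)` with `N(P) ∈ E₀(K) ∖ E₁(K)`" (`N(P) ∈ E₀(K)` is automatic).
[cite: SilvermanAEC2009, VII.2 Prop. 2.1] -/
theorem exists_norm_not_mem_kernel_iff :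
    (∃ P ∈ (((integralModelInt W).map (Int.castRingHom ℤ_[p])).map (coeffHom p K)).nonsingularReductionSubgroup
        (Valuation.integer.integers (NormedField.valuation (K := K))),
      (∑ σ : K ≃ₐ[ℚ_[p]] K, Affine.Point.map
          (W' := (((integralModelInt W).map (Int.castRingHom ℤ_[p])).map PadicInt.Coe.ringHom).toAffine)
          (σ : K →ₐ[ℚ_[p]] K) P) ∉
        kernel (NormedField.valuation (K := K)) (curveK p K ((integralModelInt W).map (Int.castRingHom ℤ_[p])))) ↔
    ∃ P ∈ (((integralModelInt W).map (Int.castRingHom ℤ_[p])).map (coeffHom p K)).nonsingularReductionSubgroup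
        (Valuation.integer.integers (NormedField.valuation (K := K))),
      (∑ σ : K ≃ₐ[ℚ_[p]] K, Affine.Point.map
          (W' := (((integralModelInt W).map (Int.castRingHom ℤ_[p])).map PadicInt.Coe.ringHom).toAffine)
          (σ : K →ₐ[ℚ_[p]] K) P) ∈
        (((integralModelInt W).map (Int.castRingHom ℤ_[p])).map (coeffHom p K)).nonsingularReductionSubgroup
          (Valuation.integer.integers (NormedField.valuation (K := K))) ∧
      (∑ σ : K ≃ₐ[ℚ_[p]] K, Affine.Point.map
          (W' := (((integralModelInt W).map (Int.castRingHom ℤ_[p])).map PadicInt.Coe.ringHom).toAffine)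
          (σ : K →ₐ[ℚ_[p]] K) P) ∉
        kernel (NormedField.valuation (K := K)) (curveK p K ((integralModelInt W).map (Int.castRingHom ℤ_[p]))) := by
  constructor
  · rintro ⟨P, hP, hN⟩
    exact ⟨P, hP, sum_galois_mem_nonsingularReductionSubgroup hP, hN⟩
  · rintro ⟨P, hP, -, hN⟩
    exact ⟨P, hP, hN⟩

end Summit.BirchSwinnertonDyer.BirchSwinnertonDyer.Theorems.KPort

end
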